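import Summits.CriticalPhenomena.PercolationContinuityZ3.Theorems.PercNearOneGluingNoHeavyQuantResplitDisplays
import HarnessLib

/-!
# QUANT lane / PAPER-2 rate track (ARM-2, gen 11): the re-balanced cascade at the Peierls constant `2⁻³` in the dimensions `d = 7, 8, 9, 10` —
# orbit defects to the last binary digit and the numeral displays `π_{p_c(ℤ^d)}(N) ≤ (1 − 2^{−a_d})^⌊(log*₂ N − 6)/2⌋`,
# `a₇ = 69866`, `a₈ = 161085`, `a₉ = 365242`, `a₁₀ = 817280` (tree cascade at `2⁻³`: `77720`, `179038`, `405636`, `907045`, `…QuantThreeDisplaysMidD`)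

builds on p205010 (kernel theorem, internal audit signed; external expert review pending)

Cell `prim-quant`, seat `prim-quant-arm-2` (constants bookkeeper), `RATE-CONSTANTS.md` §2j (lever (L1d), tolerance re-split).  Completes the `2⁻³`
table of `…QuantResplitDisplays` (`d = 3..6`: `1776, 4817, 12211, 29647`; every `3 ≤ d ≤ 32` in closed form) over the calibration dimensions
`d = 7..10`: the cast form `rsTauU_eighth_pow_castForm` + `Quant.one_div_sandwich_of_nat` (two kernel-decided integer comparisons each), then
ARM-2 g2's display schema with the bridge `rsLHi_le_knLHi` and `knShiftC d = 6` (`3 ≤ d ≤ 32`).  Plus (§2) the DOMINATION lemma `epsOrbit_le_rsOrbit`: at EVERY Peierls constant `0 < ε ≤ 1` the re-balanced cascade certifies at least the tree cascade's defect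
(`epsDeltaE ε d ≤ rsDeltaE ε d`, `d ≥ 1`).  Calibration lines only; class of the rate
(iterated logarithm) and the honest sentence UNCHANGED.  Second implementation: `quant/prim-quant-arm-2-g11/code/resplit_numerals.py`.
[cite: KozmaNitzan2024, §4 Theorem 6 (pp. 25–31)] [cite: DuminilcopinKozmaTassion2020, Proposition 1]
-/

noncomputable section

namespace Summit.CriticalPhenomena.PercolationContinuityZ3.Theorems.Quant

open MeasureTheory Literature.Probability.Percolation Literature.Probability.LatticeModels

namespace Resplit

/-! ## Orbit defects of the re-balanced cascade at `2⁻³`, `d = 7, 8, 9, 10`, to the last binary digit -/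

/-- **`d = 7` at `2⁻³`: `(1/2)^69866 < rsTauU 2⁻³ 7 ^ 896 < (1/2)^69865`** (tree cascade: `77720/77719`). [folklore] (numeric) -/
theorem rsOrbit_three_seven_sharp :
    (1 / 2 : ℝ) ^ 69866 < rsTauU ((1 / 2 : ℝ) ^ 3) 7 ^ (7 * 2 ^ 7) ∧ rsTauU ((1 / 2 : ℝ) ^ 3) 7 ^ (7 * 2 ^ 7) < (1 / 2 : ℝ) ^ 69865 := by
  rw [rsTauU_eighth_pow_castForm (by norm_num)]
  exact one_div_sandwich_of_nat (A := 2 ^ (7 * 2 ^ 7)) (C := 6021120000 * (7 + 1) ^ 2) (Klo := 1) (Khi := 1) (K := 1)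
    (n := 2 * (7 * 2 ^ 7)) (a := 69865) (by positivity) (by positivity) (by norm_num) le_rfl le_rfl
    (by decide +kernel) (by decide +kernel)

/-- **`d = 8` at `2⁻³`: `(1/2)^161085 < rsTauU 2⁻³ 8 ^ 2048 < (1/2)^161084`** (tree cascade: `179038/179037`). [folklore] (numeric) -/
theorem rsOrbit_three_eight_sharp :
    (1 / 2 : ℝ) ^ 161085 < rsTauU ((1 / 2 : ℝ) ^ 3) 8 ^ (8 * 2 ^ 8) ∧ rsTauU ((1 / 2 : ℝ) ^ 3) 8 ^ (8 * 2 ^ 8) < (1 / 2 : ℝ) ^ 161084 := by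
  rw [rsTauU_eighth_pow_castForm (by norm_num)]
  exact one_div_sandwich_of_nat (A := 2 ^ (8 * 2 ^ 8)) (C := 6021120000 * (8 + 1) ^ 2) (Klo := 1) (Khi := 1) (K := 1)
    (n := 2 * (8 * 2 ^ 8)) (a := 161084) (by positivity) (by positivity) (by norm_num) le_rfl le_rfl
    (by decide +kernel) (by decide +kernel)

/-- **`d = 9` at `2⁻³`: `(1/2)^365242 < rsTauU 2⁻³ 9 ^ 4608 < (1/2)^365241`** (tree cascade: `405636/405635`). [folklore] (numeric) -/
theorem rsOrbit_three_nine_sharp :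
    (1 / 2 : ℝ) ^ 365242 < rsTauU ((1 / 2 : ℝ) ^ 3) 9 ^ (9 * 2 ^ 9) ∧ rsTauU ((1 / 2 : ℝ) ^ 3) 9 ^ (9 * 2 ^ 9) < (1 / 2 : ℝ) ^ 365241 := by
  rw [rsTauU_eighth_pow_castForm (by norm_num)]
  exact one_div_sandwich_of_nat (A := 2 ^ (9 * 2 ^ 9)) (C := 6021120000 * (9 + 1) ^ 2) (Klo := 1) (Khi := 1) (K := 1)
    (n := 2 * (9 * 2 ^ 9)) (a := 365241) (by positivity) (by positivity) (by norm_num) le_rfl le_rfl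
    (by decide +kernel) (by decide +kernel)

/-- **`d = 10` at `2⁻³`: `(1/2)^817280 < rsTauU 2⁻³ 10 ^ 10240 < (1/2)^817279`** (tree cascade: `907045/907044`). [folklore] (numeric) -/
theorem rsOrbit_three_ten_sharp :
    (1 / 2 : ℝ) ^ 817280 < rsTauU ((1 / 2 : ℝ) ^ 3) 10 ^ (10 * 2 ^ 10) ∧
      rsTauU ((1 / 2 : ℝ) ^ 3) 10 ^ (10 * 2 ^ 10) < (1 / 2 : ℝ) ^ 817279 := by
  rw [rsTauU_eighth_pow_castForm (by norm_num)]
  exact one_div_sandwich_of_nat (A := 2 ^ (10 * 2 ^ 10)) (C := 6021120000 * (10 + 1) ^ 2) (Klo := 1) (Khi := 1) (K := 1)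
    (n := 2 * (10 * 2 ^ 10)) (a := 817279) (by positivity) (by positivity) (by norm_num) le_rfl le_rfl
    (by decide +kernel) (by decide +kernel)

/-! ## Displays `d = 7, 8, 9, 10` -/

/-- **`ℤ⁷` at `2⁻³`, re-balanced cascade**: `π_{p_c(ℤ⁷)}(N) ≤ (1 − 2⁻⁶⁹⁸⁶⁶)^⌊(log*₂ N − 6)/2⌋` (tree: `2⁻⁷⁷⁷²⁰`).  An explicit function tending to `0` and nothing more.
builds on p205010 (kernel theorem, internal audit signed; external expert review pending). [cite: KozmaNitzan2024, §4 Theorem 6] -/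
theorem oneArm_rate_Z7_three_resplit (N : ℕ) :
    oneArmProb 7 (criticalProbI 7) N ≤ (1 - (1 / 2 : ℝ) ^ 69866) ^ ((logStar 2 N - 6) / 2) :=
  PkSharp.oneArm_le_base_pow_of_scaleDefect (by norm_num) (rsThreeScaleDefect_criticalProbI_orbit (d := 7) (by norm_num))
    (fun m => le_rsLHi _ 7 m)
    (fun m => rsLHi_le_knLHi (d := 7) (by norm_num) knEps_le_half_pow_three_div_two (by positivity) (by norm_num) m) (by positivity)
    rsOrbit_three_seven_sharp.1.le (rsTauU_pow_orbit_le_one 7 (by positivity) (by norm_num))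
    (knShiftC_eq_six_of_le32 (d := 7) (by norm_num) (by norm_num)).le N

/-- **`ℤ⁸` at `2⁻³`, re-balanced cascade**: `π_{p_c(ℤ⁸)}(N) ≤ (1 − 2⁻¹⁶¹⁰⁸⁵)^⌊(log*₂ N − 6)/2⌋` (tree: `2⁻¹⁷⁹⁰³⁸`).  An explicit function tending to `0` and nothing more.
builds on p205010 (kernel theorem, internal audit signed; external expert review pending). [cite: KozmaNitzan2024, §4 Theorem 6] -/
theorem oneArm_rate_Z8_three_resplit (N : ℕ) :
    oneArmProb 8 (criticalProbI 8) N ≤ (1 - (1 / 2 : ℝ) ^ 161085) ^ ((logStar 2 N - 6) / 2) :=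
  PkSharp.oneArm_le_base_pow_of_scaleDefect (by norm_num) (rsThreeScaleDefect_criticalProbI_orbit (d := 8) (by norm_num))
    (fun m => le_rsLHi _ 8 m)
    (fun m => rsLHi_le_knLHi (d := 8) (by norm_num) knEps_le_half_pow_three_div_two (by positivity) (by norm_num) m) (by positivity)
    rsOrbit_three_eight_sharp.1.le (rsTauU_pow_orbit_le_one 8 (by positivity) (by norm_num))
    (knShiftC_eq_six_of_le32 (d := 8) (by norm_num) (by norm_num)).le N

/-- **`ℤ⁹` at `2⁻³`, re-balanced cascade**: `π_{p_c(ℤ⁹)}(N) ≤ (1 − 2⁻³⁶⁵²⁴²)^⌊(log*₂ N − 6)/2⌋` (tree: `2⁻⁴⁰⁵⁶³⁶`).  An explicit function tending to `0` and nothing more.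
builds on p205010 (kernel theorem, internal audit signed; external expert review pending). [cite: KozmaNitzan2024, §4 Theorem 6] -/
theorem oneArm_rate_Z9_three_resplit (N : ℕ) :
    oneArmProb 9 (criticalProbI 9) N ≤ (1 - (1 / 2 : ℝ) ^ 365242) ^ ((logStar 2 N - 6) / 2) :=
  PkSharp.oneArm_le_base_pow_of_scaleDefect (by norm_num) (rsThreeScaleDefect_criticalProbI_orbit (d := 9) (by norm_num))
    (fun m => le_rsLHi _ 9 m)
    (fun m => rsLHi_le_knLHi (d := 9) (by norm_num) knEps_le_half_pow_three_div_two (by positivity) (by norm_num) m) (by positivity)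
    rsOrbit_three_nine_sharp.1.le (rsTauU_pow_orbit_le_one 9 (by positivity) (by norm_num))
    (knShiftC_eq_six_of_le32 (d := 9) (by norm_num) (by norm_num)).le N

/-- **`ℤ¹⁰` at `2⁻³`, re-balanced cascade**: `π_{p_c(ℤ¹⁰)}(N) ≤ (1 − 2⁻⁸¹⁷²⁸⁰)^⌊(log*₂ N − 6)/2⌋` (tree: `2⁻⁹⁰⁷⁰⁴⁵`).  An explicit function tending to `0` and nothing more.
builds on p205010 (kernel theorem, internal audit signed; external expert review pending). [cite: KozmaNitzan2024, §4 Theorem 6] -/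
theorem oneArm_rate_Z10_three_resplit (N : ℕ) :
    oneArmProb 10 (criticalProbI 10) N ≤ (1 - (1 / 2 : ℝ) ^ 817280) ^ ((logStar 2 N - 6) / 2) :=
  PkSharp.oneArm_le_base_pow_of_scaleDefect (by norm_num) (rsThreeScaleDefect_criticalProbI_orbit (d := 10) (by norm_num))
    (fun m => le_rsLHi _ 10 m)
    (fun m => rsLHi_le_knLHi (d := 10) (by norm_num) knEps_le_half_pow_three_div_two (by positivity) (by norm_num) m) (by positivity)
    rsOrbit_three_ten_sharp.1.le (rsTauU_pow_orbit_le_one 10 (by positivity) (by norm_num))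
    (knShiftC_eq_six_of_le32 (d := 10) (by norm_num) (by norm_num)).le N

/-! ## The re-balanced cascade dominates the tree's cascade at EVERY Peierls constant `0 < ε ≤ 1` -/

variable {d : ℕ} {ε : ℝ}

/-- `K_rs(ε) ≤ (5/4)·K_eps(ε) + 1` on `(0, 8]` (`⌈40L/ε⌉ ≤ 40L/ε + 1 = (5/4)(32L/ε) + 1`, `L = log(8/ε) ≥ 0`). [folklore] -/
theorem rsK_le_epsK_real (hε0 : 0 < ε) (hε8 : ε ≤ 8) : (rsK ε : ℝ) ≤ 5 / 4 * (epsK ε : ℝ) + 1 := by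
  have hL0 : 0 ≤ Real.log (8 / ε) := Real.log_nonneg (by rw [le_div_iff₀ hε0]; linarith)
  have hL : 0 ≤ Real.log (8 / ε) * (40 / ε) := by positivity
  have h1 : (⌈Real.log (8 / ε) * (40 / ε)⌉₊ : ℝ) < Real.log (8 / ε) * (40 / ε) + 1 := Nat.ceil_lt_add_one hL
  have h2 : Real.log (8 / ε) * (32 / ε) ≤ (⌈Real.log (8 / ε) * (32 / ε)⌉₊ : ℝ) := Nat.le_ceil _
  have h3 : ((⌈Real.log (8 / ε) * (32 / ε)⌉₊ : ℕ) : ℝ) ≤ epsK ε := by exact_mod_cast le_max_right 64 _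
  have h4 : (64 : ℝ) ≤ epsK ε := by exact_mod_cast epsK_ge ε
  have e : Real.log (8 / ε) * (40 / ε) = 5 / 4 * (Real.log (8 / ε) * (32 / ε)) := by ring
  unfold rsK
  rw [Nat.cast_max]
  refine max_le ?_ ?_
  · push_cast; linarith
  · linarith

/-- **`δ_E,eps(ε) ≤ δ_E,rs(ε)` at the SAME Peierls constant** (`d ≥ 1`, `0 < ε ≤ 1`): `ε²/(96²(d+1)²·200K_eps)` is below both branches of the re-balanced
`min` (`105²·100·K_rs ≤ 96²·4·200·K_eps` by `K_rs ≤ (5/4)K_eps + 1`, and `4800·140² ≤ 96²·200·K_eps` by `K_eps ≥ 64`). [folklore] -/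
theorem epsDeltaE_le_rsDeltaE (hd : 1 ≤ d) (hε0 : 0 < ε) (hε1 : ε ≤ 1) : epsDeltaE ε d ≤ rsDeltaE ε d := by
  have hK : (rsK ε : ℝ) ≤ 5 / 4 * (epsK ε : ℝ) + 1 := rsK_le_epsK_real hε0 (by linarith)
  have hK2 : (64 : ℝ) ≤ epsK ε := by exact_mod_cast epsK_ge ε
  have hK1 : (64 : ℝ) ≤ rsK ε := by exact_mod_cast rsK_ge ε
  have hd1 : (1 : ℝ) ≤ d := by exact_mod_cast hd
  have heps : epsDeltaE ε d = ε ^ 2 / ((96 * ((d : ℝ) + 1)) ^ 2 * (200 * (epsK ε : ℝ))) := by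
    unfold epsDeltaE; rw [epsTau1_eq hd]; unfold epsDeltaCorr
    have h0 : (0 : ℝ) < 96 * ((d : ℝ) + 1) := by positivity
    field_simp
  rw [heps]
  unfold rsDeltaE rsDelta rsDeltaCorr
  set D : ℝ := (d : ℝ) + 1 with hD
  have hD1 : (2 : ℝ) ≤ D := by rw [hD]; linarith
  have hε2 : 0 < ε ^ 2 := by positivity
  refine le_min ?_ ?_
  · rw [div_pow, div_div, div_le_div_iff₀ (by positivity) (by positivity)]
    have hsq : (192 : ℝ) ^ 2 ≤ (96 * D) ^ 2 := by nlinarith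
    have h1 : (105 : ℝ) ^ 2 * (100 * (rsK ε : ℝ)) ≤ (96 * D) ^ 2 * (200 * (epsK ε : ℝ)) :=
      calc (105 : ℝ) ^ 2 * (100 * (rsK ε : ℝ)) ≤ (105 : ℝ) ^ 2 * (100 * (5 / 4 * (epsK ε : ℝ) + 1)) := by nlinarith
        _ ≤ (192 : ℝ) ^ 2 * (200 * (epsK ε : ℝ)) := by nlinarith
        _ ≤ (96 * D) ^ 2 * (200 * (epsK ε : ℝ)) := by nlinarith
    nlinarith [mul_le_mul_of_nonneg_left h1 hε2.le]
  · rw [div_pow, div_div, div_le_div_iff₀ (by positivity) (by positivity)]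
    have hD0 : (0 : ℝ) < D ^ 2 := by positivity
    have h1 : (140 * D) ^ 2 * (4800 : ℝ) ≤ (96 * D) ^ 2 * (200 * (epsK ε : ℝ)) := by nlinarith
    nlinarith [mul_le_mul_of_nonneg_left h1 hε2.le]

/-- **THE RE-BALANCED CASCADE DOMINATES THE TREE'S CASCADE AT EVERY PEIERLS CONSTANT** (`d ≥ 1`, `0 < ε ≤ 1`):
`epsTauU ε d ^ (d·2^d) ≤ rsTauU ε d ^ (d·2^d)` — whatever driver threshold `ε` a future Peierls argument reaches, the re-balanced tolerances certify at least
the defect of `…QuantEpsScaleDefectOrbit` (and `2^209`-times more at `2⁻³`, `d = 3`).  Class log* either way.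
builds on p205010 (kernel theorem, internal audit signed; external expert review pending). [folklore] -/
theorem epsOrbit_le_rsOrbit (hd : 1 ≤ d) (hε0 : 0 < ε) (hε1 : ε ≤ 1) :
    epsTauU ε d ^ (d * 2 ^ d) ≤ rsTauU ε d ^ (d * 2 ^ d) := by
  refine pow_le_pow_left₀ (epsTauU_pos_of_pos d hε0).le ?_ _
  unfold epsTauU rsTauU
  have h := epsDeltaE_le_rsDeltaE hd hε0 hε1
  have h0 := (epsDeltaE_pos d hε0).le
  have := pow_le_pow_left₀ h0 h (2 : ℕ)
  linarith

end Resplit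

end Summit.CriticalPhenomena.PercolationContinuityZ3.Theorems.Quant

end
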